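import Summits.NavierStokesRegularity.NavierStokesRegularity.Theorems.TypeICertificateLadderTargetStrainCubeLambSplitNormalWeight
import Summits.NavierStokesRegularity.NavierStokesRegularity.Theorems.TypeICertificateLadderTargetStrainCubeLambSplitDepletion
import HarnessLib

/-!
# Crux `Target` = `TypeICertificateLadder.NoTypeIBlowup` (stmt-NavierStokesRegularity-1217), line
# `depletion-ladder`: THE TWO-AMPLITUDE DEPLETION INEQUALITY and the TWO-RATE RUNG

`--supports stmt-NavierStokesRegularity-1217` (helper; sequel of `…StrainCubeLambSplitNormalWeight`). Author: STA lineage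
`ns-sta-19551-p1` (g11). Unifies the split constant (p584722) and the normal-velocity rung (p586774):

* `lamb_split_cube_le_normal` — the fixed-weight two-amplitude bound with `N ↑ |S|`.
* `abs_integral_stretching_le_lambSplit_normal` — **THE TWO-AMPLITUDE DEPLETION INEQUALITY**: for a `C^∞`
  divergence-free `v : ℝ³ → ℝ³` with `|v| ≤ M`, `|v × ω| ≤ M_⊥|ω|` (`ω = curl v`), bounded gradient and
  `D⁰v, D¹v, D²v ∈ L²`, and every `λ ∈ [0,1]`:

    `|∫⟪ω, Dv ω⟫| ≤ ( √((1−λ)² M_⊥² + λ² M²/27) + (2λ/9) M ) · ‖ω‖₂ · ‖∇ω‖₂`.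

  `λ = 0` is the normal-velocity bound (`M_⊥`), `M_⊥ = M` and `λ = λ⋆` the split constant `(9+2√15)/42`, `λ = 1` the
  old chain `(2+√3)/9`: the Lamb share is paid by the velocity NORMAL to the vorticity, the strain-cube share by
  the full speed.
* `lambSplit_normal_along_flow` — the same along a classical Leray–Hopf rapidly-decaying-datum flow (Tao cover).
* `hasSmoothExtensionPast_of_twoRates` — **THE TWO-RATE RUNG**: eventual full rate `√(T−t)‖u‖ ≤ C√ν` and eventual
  normal rate `√(T−t)|u × ω̂| ≤ C_⊥√ν` with `√((1−λ)²C_⊥² + λ²C²/27) + 2λC/9 < 1` for some `λ ∈ [0,1]` ⇒ smooth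
  extension past `T` (`hasSmoothExtensionPast_of_stretching_le`). E.g. `C = 3` (beyond every constant-form rung)
  with `C_⊥ = 1`: `λ = 1/10` gives `√(0.81 + 1/300) + 1/15 = 0.968 < 1`.

WHAT THIS IS NOT: conditional criteria; nothing on Type II; not the crux. [folklore]
-/

noncomputable section

open Set Function Filter Topology MeasureTheory Finset
open scoped RealInnerProductSpace ENNReal NNReal Laplacian ContDiff
open Literature.Analysis.FluidPDE

namespace Summit.NavierStokesRegularity.NavierStokesRegularity.Theorems.DepletionLadder.StrainCube

-- the problem directory repeats the summit name (`NavierStokesRegularity/NavierStokesRegularity`)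
set_option linter.dupNamespace false

open Summit.NavierStokesRegularity.NavierStokesRegularity.Theorems.RungReynoldsOne
open Summit.NavierStokesRegularity.NavierStokesRegularity.Theorems.RungReynoldsOne.WeightedSlice
open Summit.NavierStokesRegularity.NavierStokesRegularity.Theorems.DepletionLadder

variable {v : EuclideanSpace ℝ (Fin 3) → EuclideanSpace ℝ (Fin 3)}
  {s : Fin 3 → Fin 3 → EuclideanSpace ℝ (Fin 3) → ℝ}

/-! ## The limit `N ↑ |S|`, two amplitudes -/

/-- **The two-amplitude split bound on the strain cube** (`‖v × ω‖ ≤ M_⊥‖ω‖`, `‖v‖ ≤ M`). For a `C^∞` divergence-free `v` with `|v| ≤ M`, `‖Dv‖ ≤ B`,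
`D¹v, D²v ∈ L²`, its strain `s` (`q = Σ sᵢⱼ²`) and `0 ≤ λ ≤ 1`:
`(1−λ)|∫⟪curl v, Dv curl v⟫| + λ(2√6/9)∫ q√q ≤
  √(∫‖curl curl v‖²) √((1−λ)²M_⊥²∫‖curl v‖² + (λ√6/9)²M²∫q) + M λ(2√6/9)√(2/3)√(∫q)√(∫Σ(∂ₗsᵢⱼ)²)`
(`lamb_split_weight_le_normal` at the regularised weights `√(q+ε²) − ε`, `ε → 0`). [folklore] -/
theorem lamb_split_cube_le_normal (hv : ContDiff ℝ ∞ v) (hdiv : VectorCalculus.IsDivFree v)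
    {M Mn B : ℝ} (hM : ∀ x, ‖v x‖ ≤ M) (hMn : ∀ x, ‖cross (v x) (curl v x)‖ ≤ Mn * ‖curl v x‖)
    (hB : ∀ x, ‖fderiv ℝ v x‖ ≤ B)
    (h1 : ∫⁻ x, ‖iteratedFDeriv ℝ 1 v x‖ₑ ^ 2 < ⊤) (h2 : ∫⁻ x, ‖iteratedFDeriv ℝ 2 v x‖ₑ ^ 2 < ⊤)
    (hs : ∀ i j y, s i j y = (pderiv j (fun z => v z i) y + pderiv i (fun z => v z j) y) / 2)
    {lam : ℝ} (hlam0 : 0 ≤ lam) (hlam1 : lam ≤ 1) :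
    (1 - lam) * |∫ x, ⟪curl v x, fderiv ℝ v x (curl v x)⟫| +
        lam * ((2 / 9) * Real.sqrt 6) *
          ∫ x, (∑ i, ∑ j, s i j x ^ 2) * Real.sqrt (∑ i, ∑ j, s i j x ^ 2) ≤
      Real.sqrt (∫ x, ‖curl (curl v) x‖ ^ 2) *
          Real.sqrt ((1 - lam) ^ 2 * (Mn ^ 2 * ∫ x, ‖curl v x‖ ^ 2) +
            (lam * (Real.sqrt 6 / 9)) ^ 2 * M ^ 2 * ∫ x, ∑ i, ∑ j, s i j x ^ 2) +
        M * (lam * ((2 / 9) * Real.sqrt 6) * (Real.sqrt (2 / 3) *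
          (Real.sqrt (∫ x, ∑ i, ∑ j, s i j x ^ 2) *
            Real.sqrt (∫ x, ∑ l, ∑ i, ∑ j, pderiv l (s i j) x ^ 2)))) := by
  set q : EuclideanSpace ℝ (Fin 3) → ℝ := fun x => ∑ i, ∑ j, s i j x ^ 2 with hq
  set R : ℝ := Real.sqrt (∫ x, ‖curl (curl v) x‖ ^ 2) *
          Real.sqrt ((1 - lam) ^ 2 * (Mn ^ 2 * ∫ x, ‖curl v x‖ ^ 2) + (lam * (Real.sqrt 6 / 9)) ^ 2 * M ^ 2 * ∫ x, q x) +
        M * (lam * ((2 / 9) * Real.sqrt 6) * (Real.sqrt (2 / 3) *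
          (Real.sqrt (∫ x, q x) * Real.sqrt (∫ x, ∑ l, ∑ i, ∑ j, pderiv l (s i j) x ^ 2)))) with hR
  set κ₁ : ℝ := lam * ((2 / 9) * Real.sqrt 6) with hκ₁
  have hκ₁0 : 0 ≤ κ₁ := by positivity
  have hsC := contDiff_sym hv hs
  have hq0 : ∀ x, 0 ≤ q x := fun x => sumSq_nonneg (s := s) x
  have cq : Continuous q := continuous_finsetSum _ fun i _ => continuous_finsetSum _ fun j _ =>
    ((hsC i j).continuous).pow 2
  have hB' : ∀ x, ‖iteratedFDeriv ℝ 1 v x‖ ≤ B := fun x => by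
    rw [← norm_fderiv_eq_norm_iteratedFDeriv_one]; exact hB x
  have iq : Integrable q := by
    refine integrable_of_le_iteratedFDeriv_mul hv h1 h1 cq 9 fun x => ?_
    rw [abs_of_nonneg (hq0 x)]
    nlinarith [sumSq_sym_le hv hs x]
  have iq32 : Integrable fun x => q x * Real.sqrt (q x) := by
    refine integrable_of_le_iteratedFDeriv_mul hv h1 h1 (cq.mul (Real.continuous_sqrt.comp cq)) (27 * B)
      fun x => ?_
    rw [abs_mul, abs_of_nonneg (hq0 x), abs_of_nonneg (Real.sqrt_nonneg _)]
    have T0 : 0 ≤ ‖iteratedFDeriv ℝ 1 v x‖ := norm_nonneg _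
    calc q x * Real.sqrt (q x) ≤ (9 * ‖iteratedFDeriv ℝ 1 v x‖ ^ 2) * (3 * ‖iteratedFDeriv ℝ 1 v x‖) :=
          mul_le_mul (sumSq_sym_le hv hs x) (sqrt_sumSq_sym_le hv hs x) (Real.sqrt_nonneg _) (by positivity)
      _ = (27 * ‖iteratedFDeriv ℝ 1 v x‖ * ‖iteratedFDeriv ℝ 1 v x‖) * ‖iteratedFDeriv ℝ 1 v x‖ := by ring
      _ ≤ (27 * ‖iteratedFDeriv ℝ 1 v x‖ * ‖iteratedFDeriv ℝ 1 v x‖) * B :=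
          mul_le_mul_of_nonneg_left (hB' x) (by positivity)
      _ = 27 * B * ‖iteratedFDeriv ℝ 1 v x‖ * ‖iteratedFDeriv ℝ 1 v x‖ := by ring
  -- the bound for every `ε > 0`
  have key : ∀ ε : ℝ, 0 < ε →
      (1 - lam) * |∫ x, ⟪curl v x, fderiv ℝ v x (curl v x)⟫| + κ₁ * ∫ x, q x * Real.sqrt (q x) ≤
        R + ε * (κ₁ * ∫ x, q x) := by
    intro ε hε
    set N : EuclideanSpace ℝ (Fin 3) → ℝ := fun x => Real.sqrt (q x + ε ^ 2) - ε with hN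
    have hNC : ContDiff ℝ ∞ N := contDiff_regMod hsC hε
    have hN0 : ∀ x, 0 ≤ N x := fun x => regMod_nonneg (s := s) hε x
    have hNq : ∀ x, N x ≤ Real.sqrt (q x) := fun x => regMod_le_sqrt (s := s) hε x
    have hNle : ∀ x, N x ≤ 3 * ‖iteratedFDeriv ℝ 1 v x‖ := fun x =>
      (hNq x).trans (sqrt_sumSq_sym_le hv hs x)
    have hdND : ∀ x, ∑ l, pderiv l N x ^ 2 ≤ ∑ l, ∑ i, ∑ j, pderiv l (s i j) x ^ 2 := fun x =>
      Finset.sum_le_sum fun l _ => sq_pderiv_regMod_le hsC hε l x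
    have hdN : ∀ l x, |pderiv l N x| ≤ 6 * ‖iteratedFDeriv ℝ 2 v x‖ := fun l x => by
      refine (abs_pderiv_regMod_le hsC hε l x).trans ((Real.sqrt_le_sqrt ?_).trans (sqrt_gradSq_sym_le hv hs x))
      exact Finset.single_le_sum (f := fun l => ∑ i, ∑ j, pderiv l (s i j) x ^ 2)
        (fun l _ => sumSq_nonneg (s := fun i j y => pderiv l (s i j) y) x) (Finset.mem_univ l)
    have main := lamb_split_weight_le_normal hv hdiv hM hMn hB h1 h2 hs hNC hN0 hNq hNle hdN hdND hlam0 hlam1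
    have cN : Continuous N := hNC.continuous
    have iqN : Integrable fun x => q x * N x := by
      refine iq32.mono' (cq.mul cN).aestronglyMeasurable (Eventually.of_forall fun x => ?_)
      rw [Real.norm_eq_abs, abs_mul, abs_of_nonneg (hq0 x), abs_of_nonneg (hN0 x)]
      exact mul_le_mul_of_nonneg_left (hNq x) (hq0 x)
    have iSum : Integrable fun x => q x * N x + ε * q x := iqN.add (iq.const_mul ε)
    have hsum : ∫ x, (q x * N x + ε * q x) = (∫ x, q x * N x) + ε * ∫ x, q x := by
      rw [integral_add iqN (iq.const_mul ε), integral_const_mul]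
    have step0 : ∫ x, q x * Real.sqrt (q x) ≤ (∫ x, q x * N x) + ε * ∫ x, q x := by
      rw [← hsum]
      refine integral_mono (f := fun x => q x * Real.sqrt (q x)) (g := fun x => q x * N x + ε * q x)
        iq32 iSum fun x => ?_
      have h := sqrt_sub_regMod_le (s := s) (ε := ε) x
      have hqx := hq0 x
      change q x * Real.sqrt (q x) ≤ q x * N x + ε * q x
      nlinarith
    have main' : (1 - lam) * |∫ x, ⟪curl v x, fderiv ℝ v x (curl v x)⟫| + κ₁ * ∫ x, q x * N x ≤ R := main
    have h3 := mul_le_mul_of_nonneg_left step0 hκ₁0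
    nlinarith [h3, main']
  -- let `ε → 0`
  have hQ : 0 ≤ ∫ x, q x := integral_nonneg hq0
  have hKQ : 0 ≤ κ₁ * ∫ x, q x := mul_nonneg hκ₁0 hQ
  refine le_of_forall_pos_le_add fun δ hδ => ?_
  have h := key (δ / ((κ₁ * ∫ x, q x) + 1)) (by positivity)
  have : δ / ((κ₁ * ∫ x, q x) + 1) * (κ₁ * ∫ x, q x) ≤ δ := by
    rw [div_mul_eq_mul_div, div_le_iff₀ (by positivity)]
    nlinarith
  linarith

/-! ## The two-amplitude inequality -/

/-- **THE TWO-AMPLITUDE DEPLETION INEQUALITY.** For a `C^∞` divergence-free field `v : ℝ³ → ℝ³` with `|v| ≤ M`,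
`|v × curl v| ≤ M_⊥ |curl v|`, `‖Dv‖ ≤ B`, `D⁰v, D¹v, D²v ∈ L²`, and every `0 ≤ λ ≤ 1`:
`|∫⟪curl v, Dv (curl v)⟫| ≤ (√((1−λ)²M_⊥² + λ²M²/27) + (2λ/9)M) · √(∫‖curl v‖²) · √(∫|∇ curl v|²_F)`. [folklore] -/
theorem abs_integral_stretching_le_lambSplit_normal (hv : ContDiff ℝ ∞ v)
    (hdiv : VectorCalculus.IsDivFree v)
    {M Mn B : ℝ} (hM : ∀ x, ‖v x‖ ≤ M) (hMn : ∀ x, ‖cross (v x) (curl v x)‖ ≤ Mn * ‖curl v x‖)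
    (hB : ∀ x, ‖fderiv ℝ v x‖ ≤ B)
    (h0 : ∫⁻ x, ‖iteratedFDeriv ℝ 0 v x‖ₑ ^ 2 < ⊤) (h1 : ∫⁻ x, ‖iteratedFDeriv ℝ 1 v x‖ₑ ^ 2 < ⊤)
    (h2 : ∫⁻ x, ‖iteratedFDeriv ℝ 2 v x‖ₑ ^ 2 < ⊤) {lam : ℝ} (hlam0 : 0 ≤ lam) (hlam1 : lam ≤ 1) :
    |∫ x, ⟪curl v x, fderiv ℝ v x (curl v x)⟫| ≤
      (Real.sqrt ((1 - lam) ^ 2 * Mn ^ 2 + lam ^ 2 * M ^ 2 / 27) + 2 * lam / 9 * M) *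
        Real.sqrt (∫ x, ‖curl v x‖ ^ 2) * Real.sqrt (∫ x, frobeniusNormSq (fderiv ℝ (curl v) x)) := by
  set s : Fin 3 → Fin 3 → EuclideanSpace ℝ (Fin 3) → ℝ :=
    fun i j y => (pderiv j (fun z => v z i) y + pderiv i (fun z => v z j) y) / 2 with hsdef
  have hs : ∀ i j y, s i j y = (pderiv j (fun z => v z i) y + pderiv i (fun z => v z j) y) / 2 :=
    fun i j y => rfl
  have hM0 : 0 ≤ M := (norm_nonneg _).trans (hM 0)
  set Z := ∫ x, ‖curl v x‖ ^ 2 with hZ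
  set W := ∫ x, frobeniusNormSq (fderiv ℝ (curl v) x) with hW
  set J := ∫ x, ⟪curl v x, fderiv ℝ v x (curl v x)⟫ with hJ
  have hZ0 : 0 ≤ Z := integral_nonneg fun x => sq_nonneg _
  have hW0 : 0 ≤ W := integral_nonneg fun x => frobeniusNormSq_nonneg _
  have hA := abs_integral_stretching_le_integral_cube hv hdiv hM hB h1 hs
  have hC := lamb_split_cube_le_normal hv hdiv hM hMn hB h1 h2 hs hlam0 hlam1
  have e1 : ∫ x, ∑ i, ∑ j, s i j x ^ 2 = (1 / 2) * Z := integral_sumSq_sym_eq_half hv hdiv h0 h1 hs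
  have e2 : ∫ x, ∑ l, ∑ i, ∑ j, pderiv l (s i j) x ^ 2 = (1 / 2) * W :=
    integral_gradSq_sym_eq_half hv hdiv h1 h2 hs
  have e3 : ∫ x, ‖curl (curl v) x‖ ^ 2 = W := by
    rw [hW, ← integral_norm_laplacian_sq_eq hv hdiv h1 h2]
    refine integral_congr_ae (Eventually.of_forall fun x => ?_)
    simp only [curl_curl_eq_neg_laplacian (hv.of_le (by norm_cast)) hdiv x, norm_neg]
  rw [e1, e2, e3] at hC
  -- the square roots
  have er : Real.sqrt ((1 - lam) ^ 2 * (Mn ^ 2 * Z) + (lam * (Real.sqrt 6 / 9)) ^ 2 * M ^ 2 * ((1 / 2) * Z)) =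
      Real.sqrt ((1 - lam) ^ 2 * Mn ^ 2 + lam ^ 2 * M ^ 2 / 27) * Real.sqrt Z := by
    have h6 : Real.sqrt 6 ^ 2 = 6 := Real.sq_sqrt (by norm_num)
    rw [← Real.sqrt_mul' _ hZ0]
    congr 1
    rw [mul_pow, div_pow, h6]
    ring
  have e12 : Real.sqrt ((1 / 2) * Z) * Real.sqrt ((1 / 2) * W) = (1 / 2) * (Real.sqrt Z * Real.sqrt W) := by
    rw [Real.sqrt_mul (by norm_num) Z, Real.sqrt_mul (by norm_num) W]
    have h12 : Real.sqrt (1 / 2) * Real.sqrt (1 / 2) = 1 / 2 := Real.mul_self_sqrt (by norm_num)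
    linear_combination (Real.sqrt Z * Real.sqrt W) * h12
  have h64 : Real.sqrt 6 * Real.sqrt (2 / 3) = 2 := by
    rw [← Real.sqrt_mul (by norm_num), show (6 : ℝ) * (2 / 3) = 2 ^ 2 by norm_num,
      Real.sqrt_sq (by norm_num)]
  have hc2 : lam * |J| ≤ lam * ((2 / 9) * Real.sqrt 6 *
      ∫ x, (∑ i, ∑ j, s i j x ^ 2) * Real.sqrt (∑ i, ∑ j, s i j x ^ 2)) :=
    mul_le_mul_of_nonneg_left hA hlam0
  have hRHS : Real.sqrt W * Real.sqrt ((1 - lam) ^ 2 * (Mn ^ 2 * Z) +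
        (lam * (Real.sqrt 6 / 9)) ^ 2 * M ^ 2 * ((1 / 2) * Z)) +
        M * (lam * ((2 / 9) * Real.sqrt 6) * (Real.sqrt (2 / 3) *
          (Real.sqrt ((1 / 2) * Z) * Real.sqrt ((1 / 2) * W)))) =
      (Real.sqrt ((1 - lam) ^ 2 * Mn ^ 2 + lam ^ 2 * M ^ 2 / 27) + 2 * lam / 9 * M) *
        Real.sqrt Z * Real.sqrt W := by
    rw [er, e12]
    have : M * (lam * ((2 / 9) * Real.sqrt 6) * (Real.sqrt (2 / 3) * ((1 / 2) * (Real.sqrt Z * Real.sqrt W)))) =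
        M * lam * (1 / 9) * (Real.sqrt 6 * Real.sqrt (2 / 3)) * (Real.sqrt Z * Real.sqrt W) := by ring
    rw [this, h64]
    ring
  calc |J| = (1 - lam) * |J| + lam * |J| := by ring
    _ ≤ (1 - lam) * |J| + lam * ((2 / 9) * Real.sqrt 6 *
          ∫ x, (∑ i, ∑ j, s i j x ^ 2) * Real.sqrt (∑ i, ∑ j, s i j x ^ 2)) := by linarith [hc2]
    _ = (1 - lam) * |J| + lam * ((2 / 9) * Real.sqrt 6) *
          ∫ x, (∑ i, ∑ j, s i j x ^ 2) * Real.sqrt (∑ i, ∑ j, s i j x ^ 2) := by ring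
    _ ≤ Real.sqrt W * Real.sqrt ((1 - lam) ^ 2 * (Mn ^ 2 * Z) +
        (lam * (Real.sqrt 6 / 9)) ^ 2 * M ^ 2 * ((1 / 2) * Z)) +
        M * (lam * ((2 / 9) * Real.sqrt 6) * (Real.sqrt (2 / 3) *
          (Real.sqrt ((1 / 2) * Z) * Real.sqrt ((1 / 2) * W)))) := hC
    _ = (Real.sqrt ((1 - lam) ^ 2 * Mn ^ 2 + lam ^ 2 * M ^ 2 / 27) + 2 * lam / 9 * M) *
        Real.sqrt Z * Real.sqrt W := hRHS

/-! ## Along a flow; the two-rate rung -/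

/-- **The two-amplitude inequality along a flow.** For a classical Leray–Hopf rapidly-decaying-datum solution on
`[0,T)`, every `t ∈ [0,T)`, every `M ≥ sup_x‖u(t,x)‖`, every `M_⊥` with `|u(t,x) × ω(t,x)| ≤ M_⊥|ω(t,x)|`, and
every `λ ∈ [0,1]`: `|J(t)| ≤ (√((1−λ)²M_⊥² + λ²M²/27) + (2λ/9)M)·‖ω(t)‖₂‖∇ω(t)‖₂`. [folklore] -/
theorem lambSplit_normal_along_flow {ν T : ℝ} (hν : 0 < ν) (hT : 0 < T)
    {u : ℝ → EuclideanSpace ℝ (Fin 3) → EuclideanSpace ℝ (Fin 3)}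
    {p : ℝ → EuclideanSpace ℝ (Fin 3) → ℝ}
    (hsol : IsClassicalNSSolutionOn (Ico 0 T) ν 0 u p) (hLH : IsLerayHopfOn T ν 0 (u 0) u)
    (hdec : HasRapidSpatialDecay (u 0)) {lam : ℝ} (hlam0 : 0 ≤ lam) (hlam1 : lam ≤ 1) :
    ∀ t ∈ Ico 0 T, ∀ (M Mn : ℝ), (∀ x, ‖u t x‖ ≤ M) →
      (∀ x, ‖cross (u t x) (curl (u t) x)‖ ≤ Mn * ‖curl (u t) x‖) →
      |∫ x, ⟪curl (u t) x, fderiv ℝ (u t) x (curl (u t) x)⟫| ≤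
        (Real.sqrt ((1 - lam) ^ 2 * Mn ^ 2 + lam ^ 2 * M ^ 2 / 27) + 2 * lam / 9 * M) *
          Real.sqrt (∫ x, ‖curl (u t) x‖ ^ 2) *
            Real.sqrt (∫ x, frobeniusNormSq (fderiv ℝ (curl (u t)) x)) := by
  intro t ht M Mn hM hMn
  have ht' : (t + T) / 2 ∈ Ioo 0 T := ⟨by linarith [ht.1], by linarith [ht.2]⟩
  obtain ⟨q, hsolt, hut, -, -⟩ := stub_taoCover hν hT hsol hLH hdec ht'
  have htI : t ∈ Icc 0 ((t + T) / 2) := ⟨ht.1, by linarith [ht.2]⟩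
  obtain ⟨C₀, hC₀⟩ := hut 0
  obtain ⟨C₁, hC₁⟩ := hut 1
  obtain ⟨C₂, hC₂⟩ := hut 2
  obtain ⟨B₁, -, hB₁⟩ := exists_forall_norm_fderiv_le_of_hasBoundedSobolevNormsOn
    (fun s hs => (hsolt.contDiff_velocity hs).of_le (by norm_cast)) hut
  have h0 : ∫⁻ x, ‖iteratedFDeriv ℝ 0 (u t) x‖ₑ ^ 2 < ⊤ := (hC₀ t htI).trans_lt ENNReal.coe_lt_top
  have h1 : ∫⁻ x, ‖iteratedFDeriv ℝ 1 (u t) x‖ₑ ^ 2 < ⊤ := (hC₁ t htI).trans_lt ENNReal.coe_lt_top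
  have h2 : ∫⁻ x, ‖iteratedFDeriv ℝ 2 (u t) x‖ₑ ^ 2 < ⊤ := (hC₂ t htI).trans_lt ENNReal.coe_lt_top
  exact abs_integral_stretching_le_lambSplit_normal (hsol.contDiff_velocity ht) (hsol.divFree t ht) hM hMn
    (hB₁ t htI) h0 h1 h2 hlam0 hlam1

/-- **THE TWO-RATE RUNG.** A classical solution of the unforced Navier–Stokes system on `ℝ³ × [0,T)`
(`ν, T > 0`), Leray–Hopf from its rapidly decaying datum, with eventual FULL rate `√(T−t)‖u(t,x)‖ ≤ C√ν` and
eventual NORMAL rate `√(T−t)|u(t,x) × ω(t,x)| ≤ C_⊥√ν|ω(t,x)|`, extends smoothly past `T` as soon as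
`√((1−λ)²C_⊥² + λ²C²/27) + (2λ/9)C < 1` for some `λ ∈ [0,1]` (the stretching-number criterion
`hasSmoothExtensionPast_of_stretching_le` with that `γ`). [folklore] -/
theorem hasSmoothExtensionPast_of_twoRates {ν T C Cn lam : ℝ} (hν : 0 < ν) (hT : 0 < T) (hC : 0 ≤ C)
    (hlam0 : 0 ≤ lam) (hlam1 : lam ≤ 1)
    (hγ : Real.sqrt ((1 - lam) ^ 2 * Cn ^ 2 + lam ^ 2 * C ^ 2 / 27) + 2 * lam / 9 * C < 1)
    {u : ℝ → EuclideanSpace ℝ (Fin 3) → EuclideanSpace ℝ (Fin 3)}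
    {p : ℝ → EuclideanSpace ℝ (Fin 3) → ℝ}
    (hsol : IsClassicalNSSolutionOn (Ico 0 T) ν 0 u p) (hLH : IsLerayHopfOn T ν 0 (u 0) u)
    (hdec : HasRapidSpatialDecay (u 0))
    (hrate : ∀ᶠ t in 𝓝[<] T, ∀ x, Real.sqrt (T - t) * ‖u t x‖ ≤ C * Real.sqrt ν)
    (hnrate : ∀ᶠ t in 𝓝[<] T, ∀ x,
      Real.sqrt (T - t) * ‖cross (u t x) (curl (u t) x)‖ ≤ Cn * Real.sqrt ν * ‖curl (u t) x‖) :
    HasSmoothExtensionPast ν 0 u T := by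
  set γ : ℝ := Real.sqrt ((1 - lam) ^ 2 * Cn ^ 2 + lam ^ 2 * C ^ 2 / 27) + 2 * lam / 9 * C with hγdef
  have hγ0 : 0 ≤ γ := by positivity
  refine hasSmoothExtensionPast_of_stretching_le hν hT hγ0 hγ hsol hLH hdec ?_
  have hlt : ∀ᶠ t in 𝓝[<] T, t < T := self_mem_nhdsWithin
  have hpos : ∀ᶠ t in 𝓝[<] T, 0 ≤ t := by
    have : Ioo 0 T ∈ 𝓝[<] T := Ioo_mem_nhdsLT hT
    filter_upwards [this] with t ht using ht.1.le
  filter_upwards [hrate, hnrate, hlt, hpos] with t hr hn htT ht0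
  have hTt : 0 < T - t := sub_pos.2 htT
  have hsq : 0 < Real.sqrt (T - t) := Real.sqrt_pos.2 hTt
  -- the two amplitudes at time `t`
  set M : ℝ := C * Real.sqrt ν / Real.sqrt (T - t) with hMdef
  set Mn : ℝ := Cn * Real.sqrt ν / Real.sqrt (T - t) with hMndef
  have hM : ∀ x, ‖u t x‖ ≤ M := fun x => by
    rw [hMdef, le_div_iff₀ hsq, mul_comm]; exact hr x
  have hMn : ∀ x, ‖cross (u t x) (curl (u t) x)‖ ≤ Mn * ‖curl (u t) x‖ := fun x => by
    rw [hMndef, div_mul_eq_mul_div, le_div_iff₀ hsq, mul_comm]; exact hn x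
  have h := lambSplit_normal_along_flow hν hT hsol hLH hdec hlam0 hlam1 t ⟨ht0, htT⟩ M Mn hM hMn
  -- the constant in front is `γ √(ν/(T−t))`
  have hsqν : Real.sqrt (ν / (T - t)) = Real.sqrt ν / Real.sqrt (T - t) := Real.sqrt_div' ν hTt.le
  have hfac : Real.sqrt ((1 - lam) ^ 2 * Mn ^ 2 + lam ^ 2 * M ^ 2 / 27) + 2 * lam / 9 * M =
      γ * Real.sqrt (ν / (T - t)) := by
    have hr0 : 0 ≤ Real.sqrt ν / Real.sqrt (T - t) := by positivity
    have e : (1 - lam) ^ 2 * Mn ^ 2 + lam ^ 2 * M ^ 2 / 27 =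
        ((1 - lam) ^ 2 * Cn ^ 2 + lam ^ 2 * C ^ 2 / 27) * (Real.sqrt ν / Real.sqrt (T - t)) ^ 2 := by
      rw [hMdef, hMndef]; ring
    rw [hsqν, e, Real.sqrt_mul' _ (sq_nonneg _), Real.sqrt_sq hr0, hγdef, hMdef]
    ring
  rw [hfac] at h
  exact (le_abs_self _).trans h

end Summit.NavierStokesRegularity.NavierStokesRegularity.Theorems.DepletionLadder.StrainCube

end
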